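import Literature.NumberTheory.LFunctions.BurnolHardyRightPaleyWiener
import HarnessLib

/-!
# Vertical-line `L²` norms of `ℍ²(Re s > ½)` functions are antitone in the abscissa

LINE 1 — LABEL: RH-FREE (folklore Hardy-space analysis; `ζ` does not occur). bears_on: B-C/B-P
(LADDER-RH COLUMN 6, de Branges framework) as TOOLING ONLY: this is the step "it will thus be enough to
prove that the series above is `L²`-absolutely convergent on the line `Re(Z) = −1/2`, *as the norms are
bigger on this line than on the critical line*" of the printed proof of [Burnol2004b, Thm. 5.2]
(arXiv:math/0203120v7 p. 13, TeX l.1093–1097), isolated as a generic lemma about the tree's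
`Literature.NumberTheory.LFunctions.IsHardyRight` (`ℍ² = H²(Re s > ½)` in the analytic picture:
holomorphic on the open half-plane with uniformly bounded `L²` norms on vertical lines). WHAT THIS IS
NOT: not a statement about `ζ`, its zeros, or RH; not a route, not a criterion; nothing here bears on
the truth of RH.

Theorem-only support module (no definition, no named fact) for `BurnolZetaSystemsHardy.lean` /
the `L²` clause of `Burnol2004b_thm5_2`.

## Results (all PROVED)

* `IsHardyRight.integral_norm_sq_line_antitone` — for `F ∈ ℍ²` and `½ < σ₁ ≤ σ₂`:
  `∫ ‖F(σ₂ + iτ)‖² dτ ≤ ∫ ‖F(σ₁ + iτ)‖² dτ`. Proof: Paley–Wiener in Mellin coordinates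
  (`IsHardyRight.exists_rightMellin_eq`: `F = φ̂` on `Re s > ½` with `φ ∈ L²` vanishing on `t ≤ 1`)
  and Mellin–Plancherel on vertical lines (`integral_norm_sq_rightMellin_eq`:
  `∫‖φ̂(σ+iτ)‖²dτ = 2π∫₀^∞‖φ(t)‖²t^{1−2σ}dt`), whose right-hand side is antitone in `σ` because
  `t^{1−2σ}` is, for `t ≥ 1`. [Rudin1987, Thm. 19.2] is the underlying Paley–Wiener theorem.
* `IsHardyRight.eLpNorm_line_antitone` — the same in `eLpNorm … 2` form.
* `integral_norm_sq_line_antitone_of_halfPlane`, `eLpNorm_line_antitone_of_halfPlane` — the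
  translated form for the Hardy space of an arbitrary right half-plane `{Re z > σ₀}` (holomorphic
  there, `L²` on vertical lines with a uniform bound): `σ₀ < σ₁ ≤ σ₂ ⇒ ‖Φ(σ₂+i·)‖₂ ≤ ‖Φ(σ₁+i·)‖₂`.
* `eLpNorm_line_antitone_of_halfPlane_of_ae_eq` — the same for functions agreeing with such a `Φ`
  almost everywhere on the two lines (e.g. off a finite set of patched removable singularities).

## References

* J.-F. Burnol, *Two complete and minimal systems associated with the zeros of the Riemann zeta
  function*, J. Théor. Nombres Bordeaux 16 (2004) 65–94 = arXiv:math/0203120v7, proof of Thm. 5.2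
  (TeX of record `dbl/src/Burnol2004JTNB_arXivmath0203120v7.tex`, l.1093–1097) and §4 (TeX l.626–638,
  `ℍ²` and Paley–Wiener). [key `Burnol2004b`]
* W. Rudin, *Real and complex analysis*, 3rd ed. (1987), Thm. 19.2 (Paley–Wiener for `H²` of a
  half-plane). [key `Rudin1987`]
-/

noncomputable section

open Complex Filter Topology Set MeasureTheory
open scoped Real ENNReal

namespace Literature.NumberTheory.LFunctions

namespace HardyRightLineNorms

/-- For `φ ∈ L²(ℝ)` vanishing on `(−∞, 1]` and `e ≤ 0`, `t ↦ ‖φ(t)‖² t^e` is integrable on `(0,∞)`.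
[folklore] -/
private theorem integrableOn_norm_sq_mul_rpow {φ : ℝ → ℂ} (hφ : MemLp φ 2 volume)
    (hφ0 : ∀ t : ℝ, t ≤ 1 → φ t = 0) {e : ℝ} (he : e ≤ 0) :
    IntegrableOn (fun t : ℝ ↦ ‖φ t‖ ^ 2 * t ^ e) (Ioi 0) := by
  have hφ2 : Integrable (fun t : ℝ ↦ ‖φ t‖ ^ 2) := (memLp_two_iff_integrable_sq_norm hφ.1).1 hφ
  refine Integrable.mono' hφ2.integrableOn ?_ ?_
  · exact ((hφ.1.norm.aemeasurable.pow_const 2).restrict.mul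
      ((measurable_id.pow_const e).aemeasurable)).aestronglyMeasurable
  · filter_upwards [ae_restrict_mem (μ := (volume : Measure ℝ)) measurableSet_Ioi] with t ht0
    rw [Real.norm_eq_abs, abs_of_nonneg (mul_nonneg (by positivity)
      (Real.rpow_nonneg (le_of_lt ht0) _))]
    by_cases ht1 : t ≤ 1
    · rw [hφ0 t ht1, norm_zero, zero_pow two_ne_zero, zero_mul]
    · exact mul_le_of_le_one_right (by positivity)
        (Real.rpow_le_one_of_one_le_of_nonpos (le_of_lt (not_le.1 ht1)) he)

/-- For `φ` vanishing on `(−∞, 1]` and `e₂ ≤ e₁`: `‖φ(t)‖² t^{e₂} ≤ ‖φ(t)‖² t^{e₁}` on `(0, ∞)`.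
[folklore] -/
private theorem norm_sq_mul_rpow_le {φ : ℝ → ℂ} (hφ0 : ∀ t : ℝ, t ≤ 1 → φ t = 0) {e₁ e₂ : ℝ}
    (he : e₂ ≤ e₁) {t : ℝ} (_ht : 0 < t) :
    ‖φ t‖ ^ 2 * t ^ e₂ ≤ ‖φ t‖ ^ 2 * t ^ e₁ := by
  by_cases ht1 : t ≤ 1
  · rw [hφ0 t ht1, norm_zero, zero_pow two_ne_zero, zero_mul, zero_mul]
  · exact mul_le_mul_of_nonneg_left
      (Real.rpow_le_rpow_of_exponent_le (le_of_lt (not_le.1 ht1)) he) (by positivity)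

/-- The point `σ + iτ` has real part `σ`. [folklore] -/
private theorem re_line (σ τ : ℝ) : ((σ : ℂ) + τ * I).re = σ := by simp

end HardyRightLineNorms

open HardyRightLineNorms

/-- RH-FREE. **Vertical-line `L²` norms of an `ℍ²(Re s > ½)` function are antitone in the abscissa**:
for `F ∈ ℍ²` (`IsHardyRight F`) and `½ < σ₁ ≤ σ₂`, `∫ ‖F(σ₂+iτ)‖² dτ ≤ ∫ ‖F(σ₁+iτ)‖² dτ`. By
Paley–Wiener in Mellin coordinates `F(s) = ∫₁^∞ φ(t)t^{−s}dt` with `φ ∈ L²(1,∞)`, and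
`∫‖F(σ+iτ)‖²dτ = 2π∫₁^∞‖φ(t)‖²t^{1−2σ}dt` is antitone in `σ`. This is the inequality "the norms are
bigger on this line [`Re Z = −½`] than on the critical line" of the printed proof of Thm. 5.2 (for the
Hardy space of `Re Z > −½`, after a translation — see `integral_norm_sq_line_antitone_of_halfPlane`).
[cite: Burnol2004b, Thm. 5.2, proof (arXiv:math/0203120v7 p. 13, TeX l.1093–1097)]
[cite: Rudin1987, Thm. 19.2] -/
theorem IsHardyRight.integral_norm_sq_line_antitone {F : ℂ → ℂ} (hF : IsHardyRight F) {σ₁ σ₂ : ℝ}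
    (h₁ : 1 / 2 < σ₁) (h₁₂ : σ₁ ≤ σ₂) :
    ∫ τ : ℝ, ‖F (σ₂ + τ * I)‖ ^ 2 ≤ ∫ τ : ℝ, ‖F (σ₁ + τ * I)‖ ^ 2 := by
  obtain ⟨φ, -, hφ0, hφ2, hφF⟩ := hF.exists_rightMellin_eq
  have hφ0' : ∀ᵐ t : ℝ, t ≤ 1 → φ t = 0 := ae_of_all _ hφ0
  have h₂ : 1 / 2 < σ₂ := lt_of_lt_of_le h₁ h₁₂
  have key : ∀ {σ : ℝ}, 1 / 2 < σ →
      ∫ τ : ℝ, ‖F (σ + τ * I)‖ ^ 2 = 2 * π * ∫ t in Ioi (0 : ℝ), ‖φ t‖ ^ 2 * t ^ (1 - 2 * σ) := by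
    intro σ hσ
    rw [← (integral_norm_sq_rightMellin_eq hφ2 hφ0' hσ).2]
    refine integral_congr_ae (ae_of_all _ fun τ ↦ ?_)
    simp only
    rw [(hφF _ (by rw [re_line]; exact hσ)).2]
  rw [key h₁, key h₂]
  refine mul_le_mul_of_nonneg_left ?_ (by positivity)
  refine integral_mono_ae (integrableOn_norm_sq_mul_rpow hφ2 hφ0 (by linarith))
    (integrableOn_norm_sq_mul_rpow hφ2 hφ0 (by linarith)) ?_
  filter_upwards [ae_restrict_mem (μ := (volume : Measure ℝ)) measurableSet_Ioi] with t ht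
  exact norm_sq_mul_rpow_le hφ0 (by linarith) ht

/-- RH-FREE. The `eLpNorm` form of `IsHardyRight.integral_norm_sq_line_antitone`: for `F ∈ ℍ²` and
`½ < σ₁ ≤ σ₂`, `‖F(σ₂ + i·)‖_{L²(ℝ)} ≤ ‖F(σ₁ + i·)‖_{L²(ℝ)}`.
[cite: Burnol2004b, Thm. 5.2, proof (arXiv:math/0203120v7 p. 13, TeX l.1093–1097)]
[cite: Rudin1987, Thm. 19.2] -/
theorem IsHardyRight.eLpNorm_line_antitone {F : ℂ → ℂ} (hF : IsHardyRight F) {σ₁ σ₂ : ℝ}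
    (h₁ : 1 / 2 < σ₁) (h₁₂ : σ₁ ≤ σ₂) :
    eLpNorm (fun τ : ℝ ↦ F (σ₂ + τ * I)) 2 volume ≤ eLpNorm (fun τ : ℝ ↦ F (σ₁ + τ * I)) 2 volume := by
  have h₂ : 1 / 2 < σ₂ := lt_of_lt_of_le h₁ h₁₂
  obtain ⟨hd, C, hC⟩ := hF
  have hm₁ : MemLp (fun τ : ℝ ↦ F (σ₁ + τ * I)) 2 volume := (hC σ₁ h₁).1
  have hm₂ : MemLp (fun τ : ℝ ↦ F (σ₂ + τ * I)) 2 volume := (hC σ₂ h₂).1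
  have hle := IsHardyRight.integral_norm_sq_line_antitone ⟨hd, C, hC⟩ h₁ h₁₂
  rw [hm₁.eLpNorm_eq_integral_rpow_norm two_ne_zero ENNReal.ofNat_ne_top,
    hm₂.eLpNorm_eq_integral_rpow_norm two_ne_zero ENNReal.ofNat_ne_top]
  simp only [ENNReal.toReal_ofNat, Real.rpow_two]
  refine ENNReal.ofReal_le_ofReal (Real.rpow_le_rpow ?_ hle (by norm_num))
  exact integral_nonneg fun τ ↦ by positivity

/-- RH-FREE. **The same for the Hardy space of any right half-plane `{Re z > σ₀}`**: if `Φ` is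
holomorphic on `{Re z > σ₀}`, square-integrable on each vertical line `Re z = σ > σ₀` with a uniform
bound on `∫‖Φ(σ+iτ)‖²dτ`, then for `σ₀ < σ₁ ≤ σ₂` one has `∫‖Φ(σ₂+iτ)‖²dτ ≤ ∫‖Φ(σ₁+iτ)‖²dτ`
(translate by `σ₀ − ½` to `ℍ²(Re s > ½)`). With `σ₀ = −½ − δ`, `σ₁ = −½`, `σ₂ = ½` this is literally
"the norms are bigger on the line `Re Z = −½` than on the critical line" (proof of Thm. 5.2).
[cite: Burnol2004b, Thm. 5.2, proof (arXiv:math/0203120v7 p. 13, TeX l.1093–1097)]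
[cite: Rudin1987, Thm. 19.2] -/
theorem integral_norm_sq_line_antitone_of_halfPlane {Φ : ℂ → ℂ} {σ₀ : ℝ}
    (hd : DifferentiableOn ℂ Φ {z : ℂ | σ₀ < z.re})
    (h2 : ∀ σ : ℝ, σ₀ < σ → MemLp (fun τ : ℝ ↦ Φ (σ + τ * I)) 2 volume)
    {M : ℝ} (hM : ∀ σ : ℝ, σ₀ < σ → ∫ τ : ℝ, ‖Φ (σ + τ * I)‖ ^ 2 ≤ M)
    {σ₁ σ₂ : ℝ} (h₁ : σ₀ < σ₁) (h₁₂ : σ₁ ≤ σ₂) :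
    ∫ τ : ℝ, ‖Φ (σ₂ + τ * I)‖ ^ 2 ≤ ∫ τ : ℝ, ‖Φ (σ₁ + τ * I)‖ ^ 2 := by
  -- the translate `F(s) = Φ(s + σ₀ − ½)` is in `ℍ²(Re s > ½)`
  set c : ℝ := σ₀ - 1 / 2 with hc
  set F : ℂ → ℂ := fun s ↦ Φ (s + (c : ℂ)) with hF
  have hline : ∀ σ τ : ℝ, F (σ + τ * I) = Φ (((σ + c : ℝ) : ℂ) + τ * I) := by
    intro σ τ
    simp only [hF]
    congr 1
    push_cast
    ring
  have hFH : IsHardyRight F := by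
    refine ⟨?_, M, fun σ hσ ↦ ?_⟩
    · intro s hs
      have hs' : (s + (c : ℂ)) ∈ {z : ℂ | σ₀ < z.re} := by
        simp only [mem_setOf_eq, add_re, ofReal_re, hc] at hs ⊢
        linarith [hs]
      have h := (hd _ hs').differentiableAt ((isOpen_lt continuous_const continuous_re).mem_nhds hs')
      exact (h.comp s ((differentiableAt_id).add_const (c : ℂ))).differentiableWithinAt
    · have hσ' : σ₀ < σ + c := by rw [hc]; linarith
      refine ⟨?_, ?_⟩
      · exact (h2 (σ + c) hσ').ae_eq (ae_of_all _ fun τ ↦ (hline σ τ).symm)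
      · calc ∫ τ : ℝ, ‖F (σ + τ * I)‖ ^ 2 = ∫ τ : ℝ, ‖Φ (((σ + c : ℝ) : ℂ) + τ * I)‖ ^ 2 := by
              refine integral_congr_ae (ae_of_all _ fun τ ↦ ?_); simp only [hline]
          _ ≤ M := hM (σ + c) hσ'
  have h₁' : 1 / 2 < σ₁ - c := by rw [hc]; linarith
  have h₁₂' : σ₁ - c ≤ σ₂ - c := by linarith
  have key := hFH.integral_norm_sq_line_antitone h₁' h₁₂'
  have e₁ : ∀ τ : ℝ, F (((σ₁ - c : ℝ) : ℂ) + τ * I) = Φ (σ₁ + τ * I) := by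
    intro τ; rw [hline]; congr 2; push_cast; ring
  have e₂ : ∀ τ : ℝ, F (((σ₂ - c : ℝ) : ℂ) + τ * I) = Φ (σ₂ + τ * I) := by
    intro τ; rw [hline]; congr 2; push_cast; ring
  simp only [e₁, e₂] at key
  exact key

/-- RH-FREE. `eLpNorm` form of `integral_norm_sq_line_antitone_of_halfPlane`: for `Φ` in the Hardy
space of `{Re z > σ₀}` (holomorphic, uniformly `L²`-bounded on vertical lines) and `σ₀ < σ₁ ≤ σ₂`,
`‖Φ(σ₂ + i·)‖_{L²(ℝ)} ≤ ‖Φ(σ₁ + i·)‖_{L²(ℝ)}`.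
[cite: Burnol2004b, Thm. 5.2, proof (arXiv:math/0203120v7 p. 13, TeX l.1093–1097)]
[cite: Rudin1987, Thm. 19.2] -/
theorem eLpNorm_line_antitone_of_halfPlane {Φ : ℂ → ℂ} {σ₀ : ℝ}
    (hd : DifferentiableOn ℂ Φ {z : ℂ | σ₀ < z.re})
    (h2 : ∀ σ : ℝ, σ₀ < σ → MemLp (fun τ : ℝ ↦ Φ (σ + τ * I)) 2 volume)
    {M : ℝ} (hM : ∀ σ : ℝ, σ₀ < σ → ∫ τ : ℝ, ‖Φ (σ + τ * I)‖ ^ 2 ≤ M)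
    {σ₁ σ₂ : ℝ} (h₁ : σ₀ < σ₁) (h₁₂ : σ₁ ≤ σ₂) :
    eLpNorm (fun τ : ℝ ↦ Φ (σ₂ + τ * I)) 2 volume ≤
      eLpNorm (fun τ : ℝ ↦ Φ (σ₁ + τ * I)) 2 volume := by
  have h₂ : σ₀ < σ₂ := lt_of_lt_of_le h₁ h₁₂
  have hle := integral_norm_sq_line_antitone_of_halfPlane hd h2 hM h₁ h₁₂
  rw [(h2 σ₁ h₁).eLpNorm_eq_integral_rpow_norm two_ne_zero ENNReal.ofNat_ne_top,
    (h2 σ₂ h₂).eLpNorm_eq_integral_rpow_norm two_ne_zero ENNReal.ofNat_ne_top]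
  simp only [ENNReal.toReal_ofNat, Real.rpow_two]
  refine ENNReal.ofReal_le_ofReal (Real.rpow_le_rpow ?_ hle (by norm_num))
  exact integral_nonneg fun τ ↦ by positivity

/-- RH-FREE. The transfer to functions that agree with a Hardy-space function almost everywhere on the
two lines (e.g. the un-patched function with finitely many removable singularities on a line): if
`Ψ₁ =ᵐ Φ(σ₁+i·)` and `Ψ₂ =ᵐ Φ(σ₂+i·)` with `Φ` as in `eLpNorm_line_antitone_of_halfPlane`, then
`‖Ψ₂‖_{L²(ℝ)} ≤ ‖Ψ₁‖_{L²(ℝ)}`.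
[cite: Burnol2004b, Thm. 5.2, proof (arXiv:math/0203120v7 p. 13, TeX l.1093–1120)]
[cite: Rudin1987, Thm. 19.2] -/
theorem eLpNorm_line_antitone_of_halfPlane_of_ae_eq {Φ : ℂ → ℂ} {σ₀ : ℝ}
    (hd : DifferentiableOn ℂ Φ {z : ℂ | σ₀ < z.re})
    (h2 : ∀ σ : ℝ, σ₀ < σ → MemLp (fun τ : ℝ ↦ Φ (σ + τ * I)) 2 volume)
    {M : ℝ} (hM : ∀ σ : ℝ, σ₀ < σ → ∫ τ : ℝ, ‖Φ (σ + τ * I)‖ ^ 2 ≤ M)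
    {σ₁ σ₂ : ℝ} (h₁ : σ₀ < σ₁) (h₁₂ : σ₁ ≤ σ₂) {Ψ₁ Ψ₂ : ℝ → ℂ}
    (hΨ₁ : Ψ₁ =ᵐ[volume] fun τ : ℝ ↦ Φ (σ₁ + τ * I))
    (hΨ₂ : Ψ₂ =ᵐ[volume] fun τ : ℝ ↦ Φ (σ₂ + τ * I)) :
    eLpNorm Ψ₂ 2 volume ≤ eLpNorm Ψ₁ 2 volume := by
  rw [eLpNorm_congr_ae hΨ₁, eLpNorm_congr_ae hΨ₂]
  exact eLpNorm_line_antitone_of_halfPlane hd h2 hM h₁ h₁₂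

end Literature.NumberTheory.LFunctions
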